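import Summits.KontsevichZagierPeriods.KontsevichZagierPeriods.Theorems.RootDecompWalshStrataHtypeSectionEngine

/-!
# Root decomposition (Walsh strata), part 49 — H-type fibre discriminants III: pieces anywhere in the plane

From the engine on the half-strip (`InBaker.of_Hhalf'`, part 48) to bounded open pieces anywhere, for the
radicand `R_H = e x² + g − m y²` (`e, m > 0`) and its rational affine frames:

* 49.1 representations `[U, γ√R_H]` on bounded semialgebraic `U`;
* 49.2 cutting a piece by a genuine line keeps the frontier on a wall locus (`wallLocus_cut`);
* 49.3 `InBaker.of_Hquad`: a piece inside an open quadrant is carried into the half-strip `{0 < x < 1, 0 < y}`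
  with `m ≥ 1` by the rational map `(x, y) ↦ (s x/N, t y/N)` (`s, t = ±1`; `R_H` is even in both variables);
* 49.4 `InBaker.of_Hbdd`: a bounded piece anywhere (cut along both axes, rule (1): the axes are null);
* 49.5 `InBaker.of_Haff`: the radicand `R_H ∘ M` for a rational affine frame `M` (rule (2)).

All modulo the typed residual families `R-HL`, `R-HC` of part 48.
References: [KontsevichZagier2001 §1.2 rules (1)–(3)], [BCR1998 §2.2].
-/

noncomputable section

open Set MeasureTheory MvPolynomial Literature.NumberTheory.Transcendental
open Literature.ModelTheory.ExponentialFields (IsSemialgebraic isSemialgebraic_univ isSemialgebraic_empty)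
open Summit.KontsevichZagierPeriods.RootDecompWalshStrata.ConicDescent.VertexChart

namespace Summit.KontsevichZagierPeriods.RootDecompWalshStrata.ConicDescent.BallCube

/-! #### 49.1 Representations with the H-type weight -/

/-- The H-type weight `γ√R_H` is `ℚ`-semialgebraic. [BCR1998 §2.2] -/
theorem isSemialgebraicFunOn_hWt {s : Set (Fin 2 → ℝ)} (hs : IsSemialgebraic ℚ s) (γ e g m : ℚ) :
    IsSemialgebraicFunOn ℚ s fun w => (γ : ℝ) * √(hrad e g m w) :=
  ((isSemialgebraicFunOn_ratCast hs γ).mul_holds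
    (IsSemialgebraicFunOn.sqrt_holds ((isSemialgebraicFunOn_hrad e g m).mono (subset_univ s) hs))).congr
    fun w _ => by simp only [Pi.mul_apply]

/-- A bound for the H-type weight on a box. [bookkeeping] -/
theorem abs_hWt_le (γ e g m : ℚ) {R : ℝ} {w : Fin 2 → ℝ} (hw : ∀ j, |w j| ≤ R) :
    |(γ : ℝ) * √(hrad e g m w)| ≤
      |(γ : ℝ)| * (1 + (|(e : ℝ)| * R ^ 2 + |(g : ℝ)| + |(m : ℝ)| * R ^ 2)) := by
  have hR : 0 ≤ R := (abs_nonneg _).trans (hw 0)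
  set B : ℝ := |(e : ℝ)| * R ^ 2 + |(g : ℝ)| + |(m : ℝ)| * R ^ 2 with hB
  have hB0 : 0 ≤ B := by positivity
  rw [abs_mul, abs_of_nonneg (Real.sqrt_nonneg _)]
  refine mul_le_mul_of_nonneg_left ?_ (abs_nonneg _)
  have h0 : |w 0| ≤ R := hw 0
  have h1 : |w 1| ≤ R := hw 1
  have hsq0 : w 0 ^ 2 ≤ R ^ 2 := sq_le_sq' (abs_le.1 h0).1 (abs_le.1 h0).2
  have hsq1 : w 1 ^ 2 ≤ R ^ 2 := sq_le_sq' (abs_le.1 h1).1 (abs_le.1 h1).2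
  have hp : hrad e g m w ≤ B := by
    have e1 : (e : ℝ) * w 0 ^ 2 ≤ |(e : ℝ)| * R ^ 2 := by
      calc (e : ℝ) * w 0 ^ 2 ≤ |(e : ℝ) * w 0 ^ 2| := le_abs_self _
        _ = |(e : ℝ)| * w 0 ^ 2 := by rw [abs_mul, abs_of_nonneg (sq_nonneg (w 0))]
        _ ≤ |(e : ℝ)| * R ^ 2 := mul_le_mul_of_nonneg_left hsq0 (abs_nonneg _)
    have e2 : -((m : ℝ) * w 1 ^ 2) ≤ |(m : ℝ)| * R ^ 2 := by
      calc -((m : ℝ) * w 1 ^ 2) ≤ |-((m : ℝ) * w 1 ^ 2)| := le_abs_self _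
        _ = |(m : ℝ)| * w 1 ^ 2 := by rw [abs_neg, abs_mul, abs_of_nonneg (sq_nonneg (w 1))]
        _ ≤ |(m : ℝ)| * R ^ 2 := mul_le_mul_of_nonneg_left hsq1 (abs_nonneg _)
    have e3 : (g : ℝ) ≤ |(g : ℝ)| := le_abs_self _
    rw [hrad, hB]
    linarith
  calc √(hrad e g m w) ≤ √((1 + B) ^ 2) := Real.sqrt_le_sqrt (by nlinarith)
    _ = 1 + B := Real.sqrt_sq (by linarith)

/-- **A representation `[U, γ√R_H]` exists on every bounded `ℚ`-semialgebraic `U`.** [KontsevichZagier2001 §1.1] -/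
theorem exists_hRep {U : Set (Fin 2 → ℝ)} (hUs : IsSemialgebraic ℚ U) (hUb : Bornology.IsBounded U)
    (γ e g m : ℚ) :
    ∃ τ : KZ.IntegralRep 2, τ.domain = U ∧
      ∀ w ∈ τ.domain, τ.integrand w = (γ : ℝ) * √(hrad e g m w) := by
  obtain ⟨R, hR⟩ := isBounded_iff_forall_norm_le.1 hUb
  have hw : ∀ w ∈ U, ∀ j, |w j| ≤ R := fun w hw j => by
    rw [← Real.norm_eq_abs]; exact (norm_le_pi_norm w j).trans (hR w hw)
  exact ⟨bddRep U hUs hUb (fun w => (γ : ℝ) * √(hrad e g m w)) (isSemialgebraicFunOn_hWt hUs γ e g m) _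
    fun w hw' => abs_hWt_le γ e g m (hw w hw'), rfl, fun _ _ => rfl⟩

/-! #### 49.2 Cutting by a genuine line -/

/-- Cutting a piece `U` by a genuine line `L` (keeping `{L > 0}`): the new frontier lies on the old wall locus
or on `L`. [folklore] -/
theorem wallLocus_cut {R : (Fin 2 → ℝ) → ℝ} {n k : ℕ} (ℓ : Fin n → Wall) (q : Fin k → Wall) (L : Wall)
    (hL : L.k1 ≠ 0 ∨ L.k2 ≠ 0) {U : Set (Fin 2 → ℝ)}
    (hfr : ∀ u ∈ closure U, u ∉ U → u ∈ wallLocus R ℓ q) :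
    ∀ u ∈ closure (U ∩ {w | 0 < L.eval (w 0) (w 1)}), u ∉ U ∩ {w | 0 < L.eval (w 0) (w 1)} →
      u ∈ wallLocus R (Matrix.vecCons L ℓ) q := by
  intro u hu hnu
  have hu1 : u ∈ closure U := closure_mono inter_subset_left hu
  have hu2 : 0 ≤ L.eval (u 0) (u 1) := by
    have hc : IsClosed {w : Fin 2 → ℝ | 0 ≤ L.eval (w 0) (w 1)} :=
      isClosed_le continuous_const L.continuous_eval
    exact closure_minimal (fun w hw => by have h : 0 < L.eval (w 0) (w 1) := hw.2; exact h.le) hc hu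
  by_cases huU : u ∈ U
  · have h0 : L.eval (u 0) (u 1) = 0 := by
      by_contra hne
      exact hnu ⟨huU, lt_of_le_of_ne hu2 (Ne.symm hne)⟩
    exact Or.inr (Or.inl ⟨0, by simpa using hL, by simpa using h0⟩)
  · rcases hfr u hu1 huU with h | ⟨i, hg, hi⟩ | ⟨j, hj⟩
    · exact Or.inl h
    · exact Or.inr (Or.inl ⟨i.succ, by simpa using hg, by simpa using hi⟩)
    · exact Or.inr (Or.inr ⟨j, hj⟩)

/-! #### 49.3 Pieces inside an open quadrant -/

/-- The map `(x, y) ↦ (s x/N, t y/N)`. -/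
def AffMap.hscale (s t N : ℚ) : AffMap := ⟨s / N, 0, 0, t / N, 0, 0⟩

/-- Auxiliary step `hscale_toFun_zero`. [bookkeeping] -/
theorem AffMap.hscale_toFun_zero (s t N : ℚ) (p : Fin 2 → ℝ) :
    (AffMap.hscale s t N).toFun p 0 = (s : ℝ) / N * p 0 := by
  simp only [AffMap.hscale, AffMap.toFun_zero]; push_cast; ring

/-- Auxiliary step `hscale_toFun_one`. [bookkeeping] -/
theorem AffMap.hscale_toFun_one (s t N : ℚ) (p : Fin 2 → ℝ) :
    (AffMap.hscale s t N).toFun p 1 = (t : ℝ) / N * p 1 := by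
  simp only [AffMap.hscale, AffMap.toFun_one]; push_cast; ring

/-- Auxiliary step `hscale_det`. [bookkeeping] -/
theorem AffMap.hscale_det (s t N : ℚ) : (AffMap.hscale s t N).det = s * t / N ^ 2 := by
  simp only [AffMap.hscale, AffMap.det]; ring

/-- **H-TYPE PIECES IN AN OPEN QUADRANT (rules (2), (3)).**  A bounded open piece inside the quadrant
`{0 < s x, 0 < t y}` (`s, t = ±1`) with `R_H > 0` on it and frontier on the wall locus of `R_H`, lines `ℓ`, conic
walls `q`: `[U, γ√R_H] ∈ InBaker` modulo `R-HL`, `R-HC` — scale by `1/N` (so that `U ↦ (0,1)²` and `m N² ≥ 1`),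
reflect into the first quadrant, and run `InBaker.of_Hhalf'`. [KontsevichZagier2001 §1.2 rules (2), (3); this node] -/
theorem InBaker.of_Hquad {e g m : ℚ} (he : 0 < e) (hm : 0 < m) (γ s t : ℚ) (hs : s = 1 ∨ s = -1)
    (ht : t = 1 ∨ t = -1) {n k : ℕ} (ℓ : Fin n → Wall) (q : Fin k → Wall)
    (σ : KZ.IntegralRep 2) (hσo : IsOpen σ.domain) (hσb : Bornology.IsBounded σ.domain)
    (hσQ : σ.domain ⊆ {u | 0 < (s : ℝ) * u 0 ∧ 0 < (t : ℝ) * u 1})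
    (hD : ∀ u ∈ σ.domain, 0 < hrad e g m u)
    (hσi : ∀ u ∈ σ.domain, σ.integrand u = (γ : ℝ) * √(hrad e g m u))
    (hfr : ∀ u ∈ closure σ.domain, u ∉ σ.domain → u ∈ wallLocus (hrad e g m) ℓ q)
    (hl : (∀ (e g m γ : ℚ), 0 < e → 1 ≤ m → ∀ (L : Wall), L.k2 ≠ 0 →
      ∀ (T : Set (Fin 1 → ℝ)) (ζ : (Fin 1 → ℝ) → ℝ), IsSemialgebraic ℚ T → T ⊆ Icc 0 1 →
        IsSemialgebraicFunOn ℚ T ζ → ContinuousOn ζ T →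
        (∀ b ∈ T, (0 < b 0 ∧ (m : ℝ) * b 0 ^ 2 < 1) ∧ (0 ≤ ζ b ∧ ζ b ≤ 1) ∧
          0 < (e : ℝ) * ζ b ^ 2 + g ∧
          L.eval (ζ b) (√((e : ℝ) * ζ b ^ 2 + g) * gU m (b 0)) = 0) →
        ∀ r : KZ.IntegralRep 1, r.domain = T →
          EqOn r.integrand (fun b => (γ : ℝ) * ((e : ℝ) / 3 * ζ b ^ 3 + g * ζ b) * gW m (b 0)) T →
          InBaker (KZ.of r)))
    (hc : (∀ (e g m γ : ℚ), 0 < e → 1 ≤ m → ∀ (Q : Wall),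
      ∀ (T : Set (Fin 1 → ℝ)) (ζ : (Fin 1 → ℝ) → ℝ), IsSemialgebraic ℚ T → T ⊆ Icc 0 1 →
        IsSemialgebraicFunOn ℚ T ζ → ContinuousOn ζ T →
        (∀ b ∈ T, (0 < b 0 ∧ (m : ℝ) * b 0 ^ 2 < 1) ∧ (0 ≤ ζ b ∧ ζ b ≤ 1) ∧
          0 < (e : ℝ) * ζ b ^ 2 + g ∧
          ((e : ℝ) * ζ b ^ 2 + g) * gT m (b 0) ^ 2 =
            (Q.eval (ζ b) (√((e : ℝ) * ζ b ^ 2 + g) * gU m (b 0))) ^ 2) →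
        ∀ r : KZ.IntegralRep 1, r.domain = T →
          EqOn r.integrand (fun b => (γ : ℝ) * ((e : ℝ) / 3 * ζ b ^ 3 + g * ζ b) * gW m (b 0)) T →
          InBaker (KZ.of r))) :
    InBaker (KZ.of σ) := by
  obtain ⟨R, hR⟩ := isBounded_iff_forall_norm_le.1 hσb
  have hw : ∀ w ∈ σ.domain, ∀ j, |w j| ≤ R := fun w hw j => by
    rw [← Real.norm_eq_abs]; exact (norm_le_pi_norm w j).trans (hR w hw)
  have hm' : (0 : ℝ) < m := by exact_mod_cast hm
  obtain ⟨N, hN⟩ := exists_nat_ge (max R 0 + 1 / (m : ℝ) + 1)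
  have hR0 : 0 ≤ max R 0 := le_max_right _ _
  have h1m : 0 < 1 / (m : ℝ) := by positivity
  have hN1 : (1 : ℝ) ≤ N := by linarith
  have hN0 : (0 : ℝ) < N := by linarith
  have hNR : max R 0 < N := by linarith
  have hNpos : 0 < N := by exact_mod_cast hN0
  have hNq : (N : ℚ) ≠ 0 := by exact_mod_cast hNpos.ne'
  have hmN : (1 : ℚ) ≤ m * (N : ℚ) ^ 2 := by
    have h1 : 1 / (m : ℝ) ≤ N := by linarith
    have h2 : (1 : ℝ) ≤ m * N := by rwa [div_le_iff₀' hm'] at h1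
    have h : (1 : ℝ) ≤ (m : ℝ) * (N : ℝ) ^ 2 := by nlinarith
    exact_mod_cast h
  have heN : 0 < e * (N : ℚ) ^ 2 := by positivity
  have hs2 : (s : ℝ) ^ 2 = 1 := by rcases hs with rfl | rfl <;> norm_num
  have ht2 : (t : ℝ) ^ 2 = 1 := by rcases ht with rfl | rfl <;> norm_num
  have hsa : |(s : ℝ)| = 1 := by rcases hs with rfl | rfl <;> norm_num
  have hta : |(t : ℝ)| = 1 := by rcases ht with rfl | rfl <;> norm_num
  have hst : s * t ≠ 0 := by
    rcases hs with rfl | rfl <;> rcases ht with rfl | rfl <;> norm_num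
  have hdet : (AffMap.hscale s t N).det ≠ 0 := by
    rw [AffMap.hscale_det]; exact div_ne_zero hst (pow_ne_zero 2 hNq)
  have hN' : (N : ℝ) ≠ 0 := hN0.ne'
  have hRp : ∀ p : Fin 2 → ℝ,
      hrad (e * N ^ 2) g (m * N ^ 2) ((AffMap.hscale s t N).toFun p) = hrad e g m p := fun p => by
    rw [hrad, hrad, AffMap.hscale_toFun_zero, AffMap.hscale_toFun_one]
    have h0 : ((s : ℝ) / N * p 0) ^ 2 = p 0 ^ 2 / (N : ℝ) ^ 2 := by
      rw [mul_pow, div_pow, hs2]; ring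
    have h1 : ((t : ℝ) / N * p 1) ^ 2 = p 1 ^ 2 / (N : ℝ) ^ 2 := by
      rw [mul_pow, div_pow, ht2]; ring
    push_cast
    rw [h0, h1]
    field_simp
  obtain ⟨τ, hτd, hτi⟩ := exists_hRep ((AffMap.hscale s t N).isSemialgebraic_image σ.isSemialgebraic_domain)
    ((AffMap.hscale s t N).isBounded_image hσb) (γ * N ^ 2) (e * N ^ 2) g (m * N ^ 2)
  refine (AffMap.hscale s t N).inBaker_to hdet σ τ hτd (fun p hp => ?_) ?_
  · rw [hτi _ (by rw [hτd]; exact mem_image_of_mem _ hp), hRp, hσi p hp, AffMap.hscale_det]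
    push_cast
    rw [abs_div, abs_mul, hsa, hta, abs_of_pos (by positivity : (0 : ℝ) < (N : ℝ) ^ 2)]
    field_simp
  refine InBaker.of_Hhalf' heN hmN (γ * N ^ 2) (fun i => (ℓ i).precomp (AffMap.hscale s t N).inv)
    (fun j => (q j).precomp (AffMap.hscale s t N).inv) τ
    (by rw [hτd]; exact (AffMap.hscale s t N).isOpen_image hdet hσo) ?_ ?_ ?_ hτi hl hc
  · rw [hτd]
    rintro _ ⟨p, hp, rfl⟩
    obtain ⟨h0, h1⟩ := hσQ hp
    rw [mem_setOf_eq, AffMap.hscale_toFun_zero, AffMap.hscale_toFun_one]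
    push_cast
    rw [div_mul_eq_mul_div, div_mul_eq_mul_div, div_lt_one hN0]
    refine ⟨div_pos h0 hN0, ?_, div_pos h1 hN0⟩
    calc (s : ℝ) * p 0 ≤ |(s : ℝ) * p 0| := le_abs_self _
      _ = |p 0| := by rw [abs_mul, hsa, one_mul]
      _ ≤ R := hw p hp 0
      _ ≤ max R 0 := le_max_left _ _
      _ < N := hNR
  · rw [hτd]
    exact wallLocus_transport (AffMap.hscale s t N) hdet hRp
      (fun i p => by rw [Wall.precomp_eval, (AffMap.hscale s t N).inv_toFun hdet])
      (fun i hg => Wall.precomp_gen _ ((AffMap.hscale s t N).inv_det_ne hdet) hg)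
      (fun j p => by rw [Wall.precomp_eval, (AffMap.hscale s t N).inv_toFun hdet]) hfr
  · rw [hτd]
    rintro _ ⟨p, hp, rfl⟩
    rw [hRp]
    exact hD p hp

/-! #### 49.4 Bounded pieces anywhere -/

/-- One quadrant of a bounded piece (the piece cut by `s x > 0` and then by `t y > 0`). [this node] -/
theorem InBaker.of_Hquadrant {e g m : ℚ} (he : 0 < e) (hm : 0 < m) (γ s t : ℚ) (hs : s = 1 ∨ s = -1)
    (ht : t = 1 ∨ t = -1) {n k : ℕ} (ℓ : Fin n → Wall) (q : Fin k → Wall)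
    (σ : KZ.IntegralRep 2) (hσo : IsOpen σ.domain) (hσb : Bornology.IsBounded σ.domain)
    (hD : ∀ u ∈ σ.domain, 0 < hrad e g m u)
    (hσi : ∀ u ∈ σ.domain, σ.integrand u = (γ : ℝ) * √(hrad e g m u))
    (hfr : ∀ u ∈ closure σ.domain, u ∉ σ.domain → u ∈ wallLocus (hrad e g m) ℓ q)
    (hl : (∀ (e g m γ : ℚ), 0 < e → 1 ≤ m → ∀ (L : Wall), L.k2 ≠ 0 →
      ∀ (T : Set (Fin 1 → ℝ)) (ζ : (Fin 1 → ℝ) → ℝ), IsSemialgebraic ℚ T → T ⊆ Icc 0 1 →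
        IsSemialgebraicFunOn ℚ T ζ → ContinuousOn ζ T →
        (∀ b ∈ T, (0 < b 0 ∧ (m : ℝ) * b 0 ^ 2 < 1) ∧ (0 ≤ ζ b ∧ ζ b ≤ 1) ∧
          0 < (e : ℝ) * ζ b ^ 2 + g ∧
          L.eval (ζ b) (√((e : ℝ) * ζ b ^ 2 + g) * gU m (b 0)) = 0) →
        ∀ r : KZ.IntegralRep 1, r.domain = T →
          EqOn r.integrand (fun b => (γ : ℝ) * ((e : ℝ) / 3 * ζ b ^ 3 + g * ζ b) * gW m (b 0)) T →
          InBaker (KZ.of r)))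
    (hc : (∀ (e g m γ : ℚ), 0 < e → 1 ≤ m → ∀ (Q : Wall),
      ∀ (T : Set (Fin 1 → ℝ)) (ζ : (Fin 1 → ℝ) → ℝ), IsSemialgebraic ℚ T → T ⊆ Icc 0 1 →
        IsSemialgebraicFunOn ℚ T ζ → ContinuousOn ζ T →
        (∀ b ∈ T, (0 < b 0 ∧ (m : ℝ) * b 0 ^ 2 < 1) ∧ (0 ≤ ζ b ∧ ζ b ≤ 1) ∧
          0 < (e : ℝ) * ζ b ^ 2 + g ∧
          ((e : ℝ) * ζ b ^ 2 + g) * gT m (b 0) ^ 2 =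
            (Q.eval (ζ b) (√((e : ℝ) * ζ b ^ 2 + g) * gU m (b 0))) ^ 2) →
        ∀ r : KZ.IntegralRep 1, r.domain = T →
          EqOn r.integrand (fun b => (γ : ℝ) * ((e : ℝ) / 3 * ζ b ^ 3 + g * ζ b) * gW m (b 0)) T →
          InBaker (KZ.of r)))
    (T : Set (Fin 2 → ℝ)) (hT : IsSemialgebraic ℚ T) (hTr : T ⊆ σ.domain)
    (hTe : ∀ w, w ∈ T ↔ w ∈ σ.domain ∧ 0 < (s : ℝ) * w 0)
    (T' : Set (Fin 2 → ℝ)) (hT' : IsSemialgebraic ℚ T') (hT'r : T' ⊆ (σ.restrict T hT hTr).domain)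
    (hT'e : ∀ w, w ∈ T' ↔ w ∈ T ∧ 0 < (t : ℝ) * w 1) :
    InBaker (KZ.of ((σ.restrict T hT hTr).restrict T' hT' hT'r)) := by
  have hs0 : s ≠ 0 := by rcases hs with rfl | rfl <;> norm_num
  have ht0 : t ≠ 0 := by rcases ht with rfl | rfl <;> norm_num
  have hT'σ : T' ⊆ σ.domain := fun w hw => hTr (hT'r hw)
  have hTset : T = σ.domain ∩ {w | 0 < (⟨0, s, 0⟩ : Wall).eval (w 0) (w 1)} := by
    ext w
    rw [hTe w]
    simp only [mem_inter_iff, mem_setOf_eq, Wall.eval, Rat.cast_zero, zero_mul, add_zero, zero_add]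
  have hT'set : T' = T ∩ {w | 0 < (⟨0, 0, t⟩ : Wall).eval (w 0) (w 1)} := by
    ext w
    rw [hT'e w]
    simp only [mem_inter_iff, mem_setOf_eq, Wall.eval, Rat.cast_zero, zero_mul, add_zero, zero_add]
  refine InBaker.of_Hquad he hm γ s t hs ht (Matrix.vecCons ⟨0, 0, t⟩ (Matrix.vecCons ⟨0, s, 0⟩ ℓ)) q _
    ?_ (hσb.subset hT'σ) (fun w hw => ⟨((hTe w).1 (hT'r hw)).2, ((hT'e w).1 hw).2⟩)
    (fun w hw => hD w (hT'σ hw)) (fun w hw => hσi w (hT'σ hw)) ?_ hl hc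
  · show IsOpen T'
    rw [hT'set, hTset]
    exact (hσo.inter (isOpen_lt continuous_const (Wall.continuous_eval _))).inter
      (isOpen_lt continuous_const (Wall.continuous_eval _))
  · show ∀ u ∈ closure T', u ∉ T' → u ∈ wallLocus (hrad e g m) _ q
    rw [hT'set]
    refine wallLocus_cut _ q ⟨0, 0, t⟩ (Or.inr ht0) ?_
    rw [hTset]
    exact wallLocus_cut ℓ q ⟨0, s, 0⟩ (Or.inl hs0) hfr

/-- **H-TYPE PIECES ANYWHERE (rule (1): cut along the axes).**  A bounded open piece with `R_H > 0` on it and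
frontier on the wall locus of `R_H`, lines `ℓ`, conic walls `q`: `[U, γ√R_H] ∈ InBaker` modulo `R-HL`, `R-HC`.
[KontsevichZagier2001 §1.2 rules (1)–(3); this node] -/
theorem InBaker.of_Hbdd {e g m : ℚ} (he : 0 < e) (hm : 0 < m) (γ : ℚ) {n k : ℕ} (ℓ : Fin n → Wall)
    (q : Fin k → Wall) (σ : KZ.IntegralRep 2) (hσo : IsOpen σ.domain) (hσb : Bornology.IsBounded σ.domain)
    (hD : ∀ u ∈ σ.domain, 0 < hrad e g m u)
    (hσi : ∀ u ∈ σ.domain, σ.integrand u = (γ : ℝ) * √(hrad e g m u))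
    (hfr : ∀ u ∈ closure σ.domain, u ∉ σ.domain → u ∈ wallLocus (hrad e g m) ℓ q)
    (hl : (∀ (e g m γ : ℚ), 0 < e → 1 ≤ m → ∀ (L : Wall), L.k2 ≠ 0 →
      ∀ (T : Set (Fin 1 → ℝ)) (ζ : (Fin 1 → ℝ) → ℝ), IsSemialgebraic ℚ T → T ⊆ Icc 0 1 →
        IsSemialgebraicFunOn ℚ T ζ → ContinuousOn ζ T →
        (∀ b ∈ T, (0 < b 0 ∧ (m : ℝ) * b 0 ^ 2 < 1) ∧ (0 ≤ ζ b ∧ ζ b ≤ 1) ∧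
          0 < (e : ℝ) * ζ b ^ 2 + g ∧
          L.eval (ζ b) (√((e : ℝ) * ζ b ^ 2 + g) * gU m (b 0)) = 0) →
        ∀ r : KZ.IntegralRep 1, r.domain = T →
          EqOn r.integrand (fun b => (γ : ℝ) * ((e : ℝ) / 3 * ζ b ^ 3 + g * ζ b) * gW m (b 0)) T →
          InBaker (KZ.of r)))
    (hc : (∀ (e g m γ : ℚ), 0 < e → 1 ≤ m → ∀ (Q : Wall),
      ∀ (T : Set (Fin 1 → ℝ)) (ζ : (Fin 1 → ℝ) → ℝ), IsSemialgebraic ℚ T → T ⊆ Icc 0 1 →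
        IsSemialgebraicFunOn ℚ T ζ → ContinuousOn ζ T →
        (∀ b ∈ T, (0 < b 0 ∧ (m : ℝ) * b 0 ^ 2 < 1) ∧ (0 ≤ ζ b ∧ ζ b ≤ 1) ∧
          0 < (e : ℝ) * ζ b ^ 2 + g ∧
          ((e : ℝ) * ζ b ^ 2 + g) * gT m (b 0) ^ 2 =
            (Q.eval (ζ b) (√((e : ℝ) * ζ b ^ 2 + g) * gU m (b 0))) ^ 2) →
        ∀ r : KZ.IntegralRep 1, r.domain = T →
          EqOn r.integrand (fun b => (γ : ℝ) * ((e : ℝ) / 3 * ζ b ^ 3 + g * ζ b) * gW m (b 0)) T →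
          InBaker (KZ.of r))) :
    InBaker (KZ.of σ) := by
  refine InBaker.of_cut ⟨0, 1, 0⟩ (Or.inl one_ne_zero) σ (fun T hT hTr hTe => ?_) (fun T hT hTr hTe => ?_)
  · have hTe' : ∀ w, w ∈ T ↔ w ∈ σ.domain ∧ 0 < ((1 : ℚ) : ℝ) * w 0 := fun w => by
      rw [hTe]
      simp only [mem_inter_iff, mem_setOf_eq, Wall.eval, Rat.cast_zero, Rat.cast_one, zero_mul, add_zero,
        zero_add, one_mul]
    refine InBaker.of_cut ⟨0, 0, 1⟩ (Or.inr one_ne_zero) _ (fun T' hT' hT'r hT'e => ?_)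
      (fun T' hT' hT'r hT'e => ?_)
    · refine InBaker.of_Hquadrant he hm γ 1 1 (Or.inl rfl) (Or.inl rfl) ℓ q σ hσo hσb hD hσi hfr hl hc
        T hT hTr hTe' T' hT' hT'r fun w => ?_
      rw [hT'e]
      show w ∈ T ∩ {w : Fin 2 → ℝ | 0 < (⟨0, 0, 1⟩ : Wall).eval (w 0) (w 1)} ↔ _
      simp only [mem_inter_iff, mem_setOf_eq, Wall.eval, Rat.cast_zero, Rat.cast_one, zero_mul, add_zero,
        zero_add, one_mul]
    · refine InBaker.of_Hquadrant he hm γ 1 (-1) (Or.inl rfl) (Or.inr rfl) ℓ q σ hσo hσb hD hσi hfr hl hc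
        T hT hTr hTe' T' hT' hT'r fun w => ?_
      rw [hT'e]
      show w ∈ T ∩ {w : Fin 2 → ℝ | (⟨0, 0, 1⟩ : Wall).eval (w 0) (w 1) < 0} ↔ _
      simp only [mem_inter_iff, mem_setOf_eq, Wall.eval, Rat.cast_zero, Rat.cast_one, Rat.cast_neg, zero_mul,
        add_zero, zero_add, one_mul, neg_mul, neg_pos]
  · have hTe' : ∀ w, w ∈ T ↔ w ∈ σ.domain ∧ 0 < ((-1 : ℚ) : ℝ) * w 0 := fun w => by
      rw [hTe]
      simp only [mem_inter_iff, mem_setOf_eq, Wall.eval, Rat.cast_zero, Rat.cast_one, Rat.cast_neg, zero_mul,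
        add_zero, zero_add, one_mul, neg_mul, neg_pos]
    refine InBaker.of_cut ⟨0, 0, 1⟩ (Or.inr one_ne_zero) _ (fun T' hT' hT'r hT'e => ?_)
      (fun T' hT' hT'r hT'e => ?_)
    · refine InBaker.of_Hquadrant he hm γ (-1) 1 (Or.inr rfl) (Or.inl rfl) ℓ q σ hσo hσb hD hσi hfr hl hc
        T hT hTr hTe' T' hT' hT'r fun w => ?_
      rw [hT'e]
      show w ∈ T ∩ {w : Fin 2 → ℝ | 0 < (⟨0, 0, 1⟩ : Wall).eval (w 0) (w 1)} ↔ _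
      simp only [mem_inter_iff, mem_setOf_eq, Wall.eval, Rat.cast_zero, Rat.cast_one, zero_mul, add_zero,
        zero_add, one_mul]
    · refine InBaker.of_Hquadrant he hm γ (-1) (-1) (Or.inr rfl) (Or.inr rfl) ℓ q σ hσo hσb hD hσi hfr hl hc
        T hT hTr hTe' T' hT' hT'r fun w => ?_
      rw [hT'e]
      show w ∈ T ∩ {w : Fin 2 → ℝ | (⟨0, 0, 1⟩ : Wall).eval (w 0) (w 1) < 0} ↔ _
      simp only [mem_inter_iff, mem_setOf_eq, Wall.eval, Rat.cast_zero, Rat.cast_one, Rat.cast_neg, zero_mul,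
        add_zero, zero_add, one_mul, neg_mul, neg_pos]

/-! #### 49.5 Rational affine frames -/

/-- **H-TYPE PIECES IN A RATIONAL AFFINE FRAME (rule (2)).**  If the radicand is `R_H ∘ M` for a rational affine
`M` with `det M ≠ 0`, a bounded open piece with `R_H ∘ M > 0` and frontier on the wall locus of `R_H ∘ M`
(lines `ℓ`, conic walls `q`) carries `[U, γ√(R_H ∘ M)] ∈ InBaker` modulo `R-HL`, `R-HC`.
[KontsevichZagier2001 §1.2 rules (1)–(3); this node] -/
theorem InBaker.of_Haff (M : AffMap) (hdet : M.det ≠ 0) (γ e g m : ℚ) (he : 0 < e) (hm : 0 < m) {n k : ℕ}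
    (ℓ : Fin n → Wall) (q : Fin k → Wall)
    (σ : KZ.IntegralRep 2) (hσo : IsOpen σ.domain) (hσb : Bornology.IsBounded σ.domain)
    (hD : ∀ p ∈ σ.domain, 0 < hrad e g m (M.toFun p))
    (hσi : ∀ p ∈ σ.domain, σ.integrand p = (γ : ℝ) * √(hrad e g m (M.toFun p)))
    (hfr : ∀ p ∈ closure σ.domain, p ∉ σ.domain →
      p ∈ wallLocus (fun p => hrad e g m (M.toFun p)) ℓ q)
    (hl : (∀ (e g m γ : ℚ), 0 < e → 1 ≤ m → ∀ (L : Wall), L.k2 ≠ 0 →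
      ∀ (T : Set (Fin 1 → ℝ)) (ζ : (Fin 1 → ℝ) → ℝ), IsSemialgebraic ℚ T → T ⊆ Icc 0 1 →
        IsSemialgebraicFunOn ℚ T ζ → ContinuousOn ζ T →
        (∀ b ∈ T, (0 < b 0 ∧ (m : ℝ) * b 0 ^ 2 < 1) ∧ (0 ≤ ζ b ∧ ζ b ≤ 1) ∧
          0 < (e : ℝ) * ζ b ^ 2 + g ∧
          L.eval (ζ b) (√((e : ℝ) * ζ b ^ 2 + g) * gU m (b 0)) = 0) →
        ∀ r : KZ.IntegralRep 1, r.domain = T →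
          EqOn r.integrand (fun b => (γ : ℝ) * ((e : ℝ) / 3 * ζ b ^ 3 + g * ζ b) * gW m (b 0)) T →
          InBaker (KZ.of r)))
    (hc : (∀ (e g m γ : ℚ), 0 < e → 1 ≤ m → ∀ (Q : Wall),
      ∀ (T : Set (Fin 1 → ℝ)) (ζ : (Fin 1 → ℝ) → ℝ), IsSemialgebraic ℚ T → T ⊆ Icc 0 1 →
        IsSemialgebraicFunOn ℚ T ζ → ContinuousOn ζ T →
        (∀ b ∈ T, (0 < b 0 ∧ (m : ℝ) * b 0 ^ 2 < 1) ∧ (0 ≤ ζ b ∧ ζ b ≤ 1) ∧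
          0 < (e : ℝ) * ζ b ^ 2 + g ∧
          ((e : ℝ) * ζ b ^ 2 + g) * gT m (b 0) ^ 2 =
            (Q.eval (ζ b) (√((e : ℝ) * ζ b ^ 2 + g) * gU m (b 0))) ^ 2) →
        ∀ r : KZ.IntegralRep 1, r.domain = T →
          EqOn r.integrand (fun b => (γ : ℝ) * ((e : ℝ) / 3 * ζ b ^ 3 + g * ζ b) * gW m (b 0)) T →
          InBaker (KZ.of r))) :
    InBaker (KZ.of σ) := by
  obtain ⟨τ, hτd, hτi⟩ := exists_hRep (M.isSemialgebraic_image σ.isSemialgebraic_domain)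
    (M.isBounded_image hσb) (γ / |M.det|) e g m
  refine M.inBaker_to hdet σ τ hτd (fun p hp => ?_) ?_
  · rw [hτi _ (by rw [hτd]; exact mem_image_of_mem _ hp), hσi p hp]
    have hd : (M.det : ℝ) ≠ 0 := by exact_mod_cast hdet
    have ha : |(M.det : ℝ)| ≠ 0 := abs_ne_zero.2 hd
    push_cast
    field_simp
  refine InBaker.of_Hbdd he hm (γ / |M.det|) (fun i => (ℓ i).precomp M.inv) (fun j => (q j).precomp M.inv)
    τ (by rw [hτd]; exact M.isOpen_image hdet hσo) (by rw [hτd]; exact M.isBounded_image hσb) ?_ hτi ?_ hl hc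
  · rw [hτd]
    rintro _ ⟨p, hp, rfl⟩
    exact hD p hp
  · rw [hτd]
    exact wallLocus_transport M hdet (fun p => rfl)
      (fun i p => by rw [Wall.precomp_eval, M.inv_toFun hdet])
      (fun i hg => Wall.precomp_gen _ (M.inv_det_ne hdet) hg)
      (fun j p => by rw [Wall.precomp_eval, M.inv_toFun hdet]) hfr

end Summit.KontsevichZagierPeriods.RootDecompWalshStrata.ConicDescent.BallCube
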